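import Summits.Ventures.HSemireg.Pad4TowerSeedB1OddLemmas

/-!
# Venture HSemireg — PAD-4 on 𝔅(μ₄): LEMMA A of the LINE 5 (iii) skeleton — the A2I⁻ FLOOR RAISE at a floor unit letter (gs-eng-2 g53)

HONEST FRAMING. Lean index of the computation cell `pub-hsemireg` (S4-PUSH, H2 door PAD-4, line stmt-HodgeConjecture-18881), written by the
cell's second-code engine `gs-eng-2` (g53); sequel of `Pad4TowerSeedB1OddLemmas` (LEMMA C ∕ L ∕ U). Census-neutral: a lemma ABOUT THE TYPED
STATIC PREDICATE `A2IMinusClosed` of `Pad4TowerXresFamilies`; nothing here is an object, a σ, a seed or a census row; NOTHING HERE SAYS THAT HC ∕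
HC_CM ∕ HC_AV ∕ H2 HOLDS OR FAILS. No `sorry`, no `axiom`, no `instance`, no notation, no Literature fact.

WHAT. The A2I⁻ family of the cell's static game (xres2s `gen_a2i_w`, typed clause for clause as `XresA2IFires` ∕ `A2IMinusClosed`) read at a
FLOOR UNIT LETTER: an `N`-cell `Z` with `Z_σ = ℓ_u` and another floor unit letter `Z_{f′} = ℓ_{u′}`, whose own cancellation `q = Z(σ ↦ O)` is
present at level `P` (RULE D forces it for a fully charged floor unit cell — LEMMA U), and whose cancellation is RAISED at level `N` along the own
ray of `f′`, `N′ = Z(σ ↦ O, f′ ↦ (1+e)ℓ_{u′})`, `e ≥ 1`. Then the same raise is present at level `P` at some intermediate height: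
`Z(σ ↦ O, f′ ↦ (1+e″)ℓ_{u′}) ∈ C.upper` for some `1 ≤ e″ ≤ e` — because the A2I⁻ instance (head `Z`, partner `q`, server `N′`, server
direction `v = u′`) has, inside ◇₈, NO escape except the species-(3b) polluters, which are exactly these cells: below a floor unit letter the only
◇₈ letter is `O`, reached in the letter's own direction (so the other-direction ∕ shallower ∕ deeper partner escapes are void and every A1W
below-partner on `f′` has `f′`-direction `u′ = v`), and no ◇₈ letter is both causally below `(1+e)ℓ_{u′}` and spacelike to `ℓ_{u′}` (species (3d)
is void). This is the «IF N[ℓ₁|ℓ₁|ℓ₁|ℓ_i] & P[O|ℓ₁|ℓ₁|ℓ_i] & N[O|2ℓ₁|ℓ₁|ℓ_i] THEN P[O|2ℓ₁|ℓ₁|ℓ_i]» clause of the third code's rulebook (gs-eng-2 g53,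
`gs2∕g53∕pad4∕rulebook-floorunit.txt`), the conflict family of the floor-line classes of the ◇₈ peel (CASETABLE-peel-d8.txt: «floorline» rows,
A2I⁻ 146∕148 …). **`a2i_floor_raise`**; auxiliary: `not_spacelike_of_below_floor_ray` (no ◇₈ letter causally below `(1+e)ℓ_{u′}` is
spacelike to `ℓ_{u′}`), `not_spacelike_from_O`. And **`a2i_swap_kill`** = LEMMA A′, THE SWAP KILL (motif (M1), ALL 7 547 two-literal A2I⁻
conflicts of the ◇₈ peel, `G1DECODE-peel-d8.txt`): an `N`-cell with the apex `O` on `f′` and `ℓ_u` on `σ`, whose cancellation is a `P`-cell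
and whose (σ f′)-SWAP is an `N`-cell (automatic under `PermClosed C.lower`), has its swap at level `P` too (so, under `PermClosed C.upper`,
is itself a `P`-cell) — the S₄ transposition is the group element that does the killing.

SOURCES: `Pad4TowerXresFamilies.lean` (`XresA2IFires`, `A2IMinusClosed`, `EncDir`, `OnULineBelowEq`, `cabs`, `Spacelike`), `Pad4TowerDiamondMu4.lean`
(`InDiamond`), `Pad4TowerSeedB1OddLemmas.lean` (`fu`, `eq_O_of_inDiamond`, `inDiamond_nonneg`); note `general-structure∕PENCIL-B1ODD-gs2g53.md` §4 (LEMMA A). -/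

namespace Summit.Ventures.HSemireg.Pad4Tower

open Finset

/-- no ◇₈ letter is both causally below the floor-ray letter `(1+e)·ℓ_{u′}` (`e ≥ 0`) and spacelike-separated from `ℓ_{u′}`: the letters
causally below a floor-line letter lie on its own ray down to `O`, all null- or zero-separated from `ℓ_{u′}`. -/
theorem not_spacelike_of_below_floor_ray {h : ℤ} {y : BPoint} (hy : InDiamond h y) (u' : Fin 4) {e : ℤ} (he : 0 ≤ e)
    (heff : Effective (bsub (ray (0, 0, 0) u' (1 + e)) y)) : ¬ Spacelike (bsub y (fu u')) := by
  obtain ⟨α, b1, b2⟩ := y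
  obtain ⟨hax, hc, -, -⟩ := hy
  simp only [absCharge, chargeOf] at hc
  have hcb := abs_le.mp hc
  intro hsp
  rcases hax with h0 | ⟨-, h2⟩ | ⟨h1, -⟩
  · simp only [Prod.mk.injEq] at h0
    obtain ⟨rfl, rfl⟩ := h0
    fin_cases u' <;> simp [Effective, Spacelike] at heff hsp <;> nlinarith
  · simp only at h2; subst h2
    simp only [sub_zero] at hcb
    fin_cases u' <;> simp [Effective, Spacelike] at heff hsp <;>
      nlinarith [sq_nonneg (α - b1), sq_nonneg (α + b1), sq_nonneg b1, hcb.1, hcb.2]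
  · simp only at h1; subst h1
    simp only [zero_sub] at hcb
    fin_cases u' <;> simp [Effective, Spacelike] at heff hsp <;>
      nlinarith [sq_nonneg (α - b2), sq_nonneg (α + b2), sq_nonneg b2, hcb.1, hcb.2]

/-- **LEMMA A — THE A2I⁻ FLOOR RAISE (uniform in h).** In an `A2I⁻`-closed two-level configuration inside ◇_h, let the `N`-cell `Z` carry floor unit letters
`ℓ_u` on `σ` and `ℓ_{u′}` on `f′ ≠ σ`, let its cancellation `Z(σ ↦ O)` be present at level `P`, and let the raised cancellation
`Z(σ ↦ O, f′ ↦ (1+e)ℓ_{u′})`, `e ≥ 1`, be present at level `N`. Then `Z(σ ↦ O, f′ ↦ (1+e″)ℓ_{u′}) ∈ C.upper` for some `1 ≤ e″ ≤ e`.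
[the A2I⁻ instance (head `Z`, own direction `u`, partner the cancellation, server direction `u′`) fires unless a species-(3b) polluter is present] -/
theorem a2i_floor_raise {C : MConfig} {h : ℤ} (hU : C.InDiamond h) (hA : A2IMinusClosed C) {Z : MCell} (hZ : Z ∈ C.lower)
    {σ f' : Fin 4} (hf : f' ≠ σ) {u u' : Fin 4} (hZσ : Z σ = fu u) (hZf : Z f' = fu u')
    (hq : Function.update Z σ (0, 0, 0) ∈ C.upper) {e : ℤ} (he : 1 ≤ e)
    (hN : Function.update (Function.update Z σ (0, 0, 0)) f' (ray (0, 0, 0) u' (1 + e)) ∈ C.lower) :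
    ∃ e'' : ℤ, 1 ≤ e'' ∧ e'' ≤ e ∧ Function.update (Function.update Z σ (0, 0, 0)) f' (ray (0, 0, 0) u' (1 + e'')) ∈ C.upper := by
  by_contra hno
  push Not at hno
  set q : MCell := Function.update Z σ (0, 0, 0) with hqdef
  set N' : MCell := Function.update q f' (ray (0, 0, 0) u' (1 + e)) with hNdef
  have eqσ : q σ = (0, 0, 0) := by simp [hqdef]
  have eqg : ∀ g, g ≠ σ → q g = Z g := fun g hg => by simp [hqdef, Function.update_of_ne hg]
  have eNf : N' f' = ray (0, 0, 0) u' (1 + e) := by simp [hNdef]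
  have eNg : ∀ g, g ≠ f' → N' g = q g := fun g hg => by simp [hNdef, Function.update_of_ne hg]
  have eqf : q f' = fu u' := by rw [eqg f' hf, hZf]
  -- letters of P-cells are ◇₈ letters
  have dia : ∀ P ∈ C.upper, ∀ g, InDiamond h (P g) := fun P hP g => hU.2 P hP g
  -- below a floor unit letter: only O, in the letter's own direction
  have belowZ : ∀ P ∈ C.upper, ∀ g w, Z g = fu (if g = σ then u else u') → (g = σ ∨ g = f') →
      (P g).1 < (Z g).1 → Z g = ray (P g) w ((Z g).1 - (P g).1) → P g = (0, 0, 0) ∧ w = (if g = σ then u else u') := by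
    intro P hP g w hZg _ hlt hray
    have h0 := inDiamond_nonneg (dia P hP g)
    rw [hZg] at hlt hray
    have hPg : (P g).1 = 0 := by
      revert hlt h0; generalize (if g = σ then u else u') = uu; fin_cases uu <;> simp <;> intro h1 h2 <;> omega
    have hO := eq_O_of_inDiamond (dia P hP g) hPg
    refine ⟨hO, ?_⟩
    rw [hO] at hray; revert hray; generalize (if g = σ then u else u') = uu; fin_cases uu <;> fin_cases w <;> simp [ray]
  apply hA Z hZ q hq N' hN σ u f' u'
  refine ⟨?_, ?_, ⟨fun g hg => eqg g hg, ?_, ?_⟩, ?_, hf, ⟨fun g hg => (eNg g hg).symm, ?_, ?_⟩, ?_, ?_, ?_, ?_, ?_⟩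
  · rw [hZσ]; fin_cases u <;> simp [isApex]
  · rw [hZσ]; left; fin_cases u <;> simp [cabs, ray]
  · rw [eqσ, hZσ]; fin_cases u <;> simp
  · rw [eqσ, hZσ]; fin_cases u <;> simp [ray]
  · intro _; rw [hZσ, eqσ]; fin_cases u <;> simp [cabs]
  · rw [eqf, eNf]; fin_cases u' <;> simp <;> omega
  · rw [eqf, eNf]; fin_cases u' <;> simp [ray] <;> ring_nf
  · -- no partner of Z on σ in another direction
    intro P hP w hw hPw
    obtain ⟨-, hlt, hray⟩ := hPw
    have := (belowZ P hP σ w (by simp [hZσ]) (Or.inl rfl) hlt hray).2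
    simp at this; exact hw this
  · -- the cancellation is the topmost u-partner
    intro P hP hPu
    obtain ⟨-, hlt, hray⟩ := hPu
    have := (belowZ P hP σ u (by simp [hZσ]) (Or.inl rfl) hlt hray).1
    rw [eqσ, this]
  · -- nothing below the cancellation on the u-line
    intro P hP hqP
    obtain ⟨-, hlt, -⟩ := hqP
    rw [eqσ] at hlt
    have := inDiamond_nonneg (dia P hP σ)
    simp at hlt; omega
  · -- A1W: every below-partner of Z on f' has f'-direction u'
    intro P hP hnb _
    obtain ⟨hlt, hnull⟩ := hnb
    have h0 := inDiamond_nonneg (dia P hP f')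
    rw [hZf] at hlt
    have hPf : (P f').1 = 0 := by revert hlt h0; fin_cases u' <;> simp <;> intro h1 h2 <;> omega
    have hO := eq_O_of_inDiamond (dia P hP f') hPf
    rw [hO, hZf]; fin_cases u' <;> simp
  · -- polluters: (3b) are the excluded raises at level P, (3d) is void
    intro P hP hag hline
    have hPσ : P σ = (0, 0, 0) := by
      obtain ⟨hle, hray⟩ := hline
      rw [eqσ] at hle hray
      have h0 := inDiamond_nonneg (dia P hP σ)
      have : (P σ).1 = 0 := by omega
      rw [this] at hray; simpa [ray] using hray.symm
    constructor
    · rintro ⟨hlt, hle, hray⟩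
      rw [hZf] at hlt hray; rw [eNf] at hle
      -- P = Z(σ ↦ O, f' ↦ (1+e'')ℓ_{u'}) with e'' = (P f').1 - 1
      have hPf : P f' = ray (0, 0, 0) u' (1 + ((P f').1 - 1)) := by
        rw [hray]; fin_cases u' <;> simp [ray] <;> ring_nf
      have he1 : 1 ≤ (P f').1 - 1 := by revert hlt; fin_cases u' <;> simp
      have he2 : (P f').1 - 1 ≤ e := by revert hle; fin_cases u' <;> simp <;> omega
      apply hno ((P f').1 - 1) he1 he2
      have hPe : P = Function.update (Function.update Z σ (0, 0, 0)) f' (ray (0, 0, 0) u' (1 + ((P f').1 - 1))) := by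
        funext g
        by_cases hg : g = f'
        · subst hg; simpa using hPf
        · rw [Function.update_of_ne hg]
          by_cases hg' : g = σ
          · subst hg'; simp; exact hPσ
          · rw [Function.update_of_ne hg']; exact hag g hg' hg
      rw [← hPe]; exact hP
    · rintro ⟨heff, hsp⟩
      rw [eNf] at heff; rw [hZf] at hsp
      exact not_spacelike_of_below_floor_ray (dia P hP f') u' (by omega) heff hsp

/-- no ◇_h letter is spacelike-separated from the apex `O` (`|β| = |c| ≤ α` on an axis letter). -/
theorem not_spacelike_from_O {h : ℤ} {y : BPoint} (hy : InDiamond h y) : ¬ Spacelike (bsub y (0, 0, 0)) := by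
  obtain ⟨α, b1, b2⟩ := y
  obtain ⟨hax, hc, -, -⟩ := hy
  simp only [absCharge, chargeOf] at hc
  have hcb := abs_le.mp hc
  intro hsp
  simp only [Spacelike, sub_zero] at hsp
  rcases hax with h0 | ⟨-, h2⟩ | ⟨h1, -⟩
  · simp only [Prod.mk.injEq] at h0; obtain ⟨rfl, rfl⟩ := h0; nlinarith
  · simp only at h2; subst h2; simp only [sub_zero] at hcb; nlinarith [hcb.1, hcb.2]
  · simp only at h1; subst h1; simp only [zero_sub] at hcb; nlinarith [hcb.1, hcb.2]

/-- **LEMMA A′ — THE A2I⁻ SWAP KILL (motif (M1) of the ◇₈ peel: 7 547 of the 2-literal conflicts), UNIFORM IN h.** In an `A2I⁻`-closed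
configuration inside ANY ◇_h, let the `N`-cell `Z` carry the apex `O` on `f′` and a floor unit letter `ℓ_u` on `σ ≠ f′`, with its cancellation `Z(σ ↦ O)` present at
level `P`. If the SWAPPED cell `Z(σ ↦ O, f′ ↦ ℓ_u)` (= `(σ f′)·Z`, present at level `N` whenever `C.lower` is `S₄`-closed) is an `N`-cell, then
it is also a `P`-cell: the A2I⁻ instance (head `Z`, partner the cancellation, server the swapped cell, server direction `u`, `e = 1`) has no
escape inside ◇_h except the species-(3b) polluter, which is the swapped cell itself at level `P`. [unfolding `A2IMinusClosed`] -/
theorem a2i_swap_kill {C : MConfig} {h : ℤ} (hU : C.InDiamond h) (hA : A2IMinusClosed C) {Z : MCell} (hZ : Z ∈ C.lower)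
    {σ f' : Fin 4} (hf : f' ≠ σ) {u : Fin 4} (hZσ : Z σ = fu u) (hZf : Z f' = (0, 0, 0))
    (hq : Function.update Z σ (0, 0, 0) ∈ C.upper)
    (hN : Function.update (Function.update Z σ (0, 0, 0)) f' (fu u) ∈ C.lower) :
    Function.update (Function.update Z σ (0, 0, 0)) f' (fu u) ∈ C.upper := by
  by_contra hno
  set q : MCell := Function.update Z σ (0, 0, 0) with hqdef
  set N' : MCell := Function.update q f' (fu u) with hNdef
  have eqσ : q σ = (0, 0, 0) := by simp [hqdef]
  have eqg : ∀ g, g ≠ σ → q g = Z g := fun g hg => by simp [hqdef, Function.update_of_ne hg]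
  have eNf : N' f' = fu u := by simp [hNdef]
  have eNg : ∀ g, g ≠ f' → N' g = q g := fun g hg => by simp [hNdef, Function.update_of_ne hg]
  have eqf : q f' = (0, 0, 0) := by rw [eqg f' hf, hZf]
  have dia : ∀ P ∈ C.upper, ∀ g, InDiamond h (P g) := fun P hP g => hU.2 P hP g
  -- below the floor unit letter on σ: only O, in direction u
  have belowσ : ∀ P ∈ C.upper, ∀ w, (P σ).1 < (Z σ).1 → Z σ = ray (P σ) w ((Z σ).1 - (P σ).1) → P σ = (0, 0, 0) ∧ w = u := by
    intro P hP w hlt hray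
    have h0 := inDiamond_nonneg (dia P hP σ)
    rw [hZσ] at hlt hray
    have hPg : (P σ).1 = 0 := by revert hlt h0; fin_cases u <;> simp <;> intro h1 h2 <;> omega
    have hO := eq_O_of_inDiamond (dia P hP σ) hPg
    refine ⟨hO, ?_⟩
    rw [hO] at hray; revert hray; fin_cases u <;> fin_cases w <;> simp
  apply hA Z hZ q hq N' hN σ u f' u
  refine ⟨?_, ?_, ⟨fun g hg => eqg g hg, ?_, ?_⟩, ?_, hf, ⟨fun g hg => (eNg g hg).symm, ?_, ?_⟩, ?_, ?_, ?_, ?_, ?_⟩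
  · rw [hZσ]; fin_cases u <;> simp [isApex]
  · rw [hZσ]; left; fin_cases u <;> simp [cabs, ray]
  · rw [eqσ, hZσ]; fin_cases u <;> simp
  · rw [eqσ, hZσ]; fin_cases u <;> simp [ray]
  · intro _; rw [hZσ, eqσ]; fin_cases u <;> simp [cabs]
  · rw [eqf, eNf]; fin_cases u <;> simp
  · rw [eqf, eNf]; fin_cases u <;> simp [ray]
  · intro P hP w hw hPw
    obtain ⟨-, hlt, hray⟩ := hPw
    exact hw (belowσ P hP w hlt hray).2
  · intro P hP hPu
    obtain ⟨-, hlt, hray⟩ := hPu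
    rw [eqσ, (belowσ P hP u hlt hray).1]
  · intro P hP hqP
    obtain ⟨-, hlt, -⟩ := hqP
    rw [eqσ] at hlt
    have := inDiamond_nonneg (dia P hP σ)
    simp at hlt; omega
  · -- A1W: nothing lies strictly null-below the apex O on f'
    intro P hP hnb _
    obtain ⟨hlt, -⟩ := hnb
    rw [hZf] at hlt
    have := inDiamond_nonneg (dia P hP f')
    simp at hlt; omega
  · intro P hP hag hline
    have hPσ : P σ = (0, 0, 0) := by
      obtain ⟨hle, hray⟩ := hline
      rw [eqσ] at hle hray
      have h0 := inDiamond_nonneg (dia P hP σ)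
      have : (P σ).1 = 0 := by omega
      rw [this] at hray; simpa [ray] using hray.symm
    constructor
    · rintro ⟨hlt, hle, hray⟩
      rw [hZf] at hlt hray; rw [eNf] at hle
      -- P f' = ℓ_u, so P is the swapped cell at level P
      have hPf : P f' = fu u := by
        rw [hray]
        have h1 : (P f').1 = 1 := by revert hlt hle; fin_cases u <;> simp <;> intro h1 h2 <;> omega
        rw [h1]; simp [ray, fu]
      apply hno
      have hPe : P = Function.update (Function.update Z σ (0, 0, 0)) f' (fu u) := by
        funext g
        by_cases hg : g = f'
        · subst hg; simpa using hPf
        · rw [Function.update_of_ne hg]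
          by_cases hg' : g = σ
          · subst hg'; simp; exact hPσ
          · rw [Function.update_of_ne hg']; exact hag g hg' hg
      have hN'e : N' = P := by rw [hPe, hNdef, hqdef]
      rw [hN'e]; exact hP
    · rintro ⟨-, hsp⟩
      rw [hZf] at hsp
      exact not_spacelike_from_O (dia P hP f') hsp

end Summit.Ventures.HSemireg.Pad4Tower
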